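import Literature.MathematicalPhysics.QuantumLattice.AnisotropicKLSCauchySchwarz
import Literature.Probability.LatticeModels.AnisotropicInfraredConstantLog
import Summits.CriticalPhenomena.Ising3DConformalLimit.Theorems.PerfectScreeningSubharmonicOffOriginStubOrderBeyondThreshold
import HarnessLib

/-!
# Ventures/CertifiedManyBodySolver — Observables/LayeredQuantumXYOrder.lean

HONEST FRAMING: a statement about a COMPARISON MODEL — the layered spin-`S` quantum XY model (`S = ½`: hard-core
lattice bosons) `H = -Σ_x[Σ_{i=1,2}(S¹_xS¹_{x+eᵢ} + S²_xS²_{x+eᵢ}) + r(S¹_xS¹_{x+e₃} + S²_xS²_{x+e₃})]` on the even tori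
`(ℤ/2kℤ)³` — not about the Hubbard model and not a material number (cell `pub/hubbard-tc`, MO-S3, G1′ family:
comparison-model ORDERING FLOORS beside the certified `T_c` ceilings; ASSUMPTIONS.md §1 key K5). Cross-cell: the
reflection-positivity / infrared-bound chain is hubbard-cq's (`hubbard-pc-lit-1`: `AnisotropicXY*`, `AnisotropicKLS*`);
this file only DISCHARGES its last numerical hypothesis from a kernel decimal certified elsewhere in the tree.

* `xyLayered_longRangeOrder_half_le_one` — **unconditional long-range order of the layered quantum XY model for every
  spin `S ≥ ½` and every interlayer anisotropy `½ ≤ r ≤ 1`, at `T = 0` and for all `β ≥ β₀(r) > 0`**: hubbard-cq's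
  `xyLayered_longRangeOrder_of_latticeGreen_le` (Kennedy–Lieb–Shastry + Cauchy–Schwarz: LRO once
  `(2 + r²)·C(r) < n²(2 + r)`, and `C(r) ≤ latticeGreen 0 / r`) needs Watson's integral `latticeGreen 0 ≤ 13/25`
  (`= 0.5054…`), which is a KERNEL theorem on the summit side of the tree
  (`Summit.CriticalPhenomena.Ising3DConformalLimit.Theorems.PerfectScreening.CcetGreen.latticeGreen_zero_le`, not
  importable into `Literature/`); composing the two closes the hypothesis. Zero hypotheses remain.
* `klsConstant_window_half_le_one` — the kernel two-sided window on Fröhlich–Israel–Lieb–Simon's constant of the layered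
  dispersion on `½ ≤ r ≤ 1`: `1/6 + log(1/r)/(2π) ≤ C(r) ≤ min(13/(25r), 1 + log(1/r)/(2π))` (tree
  `klsConstant_ge_log`, `klsConstant_le_log` of the `hubbard-tc` lineage, `klsConstant_le_latticeGreen_div` +
  `latticeGreen_zero_le`).

What this is NOT: the regime `r < ½` (there `(2 + r²)C(r) < 2 + r` for `S = ½` holds down to `r ≈ 0.055` by certified
numerics of the cell — `pub/hubbard-tc/hubbard-tc-p2/K5-FLOOR-ANISO.md` §C–S — but not yet by a kernel decimal); any
Hubbard or material statement. No definition, no named fact, no computation, no `sorry`.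
-/

noncomputable section

open Literature.MathematicalPhysics.QuantumLattice Literature.Probability.LatticeModels
  Literature.Probability.LatticeModels.AnisotropicRotator
  Summit.CriticalPhenomena.Ising3DConformalLimit.Theorems.PerfectScreening.CcetGreen

namespace Summit.Ventures.CertifiedManyBodySolver.Observables

/-- **Long-range order of the layered quantum XY / hard-core-boson model, every spin `S = n/2 ≥ ½`, every
`½ ≤ r ≤ 1` — unconditional.** Ground states on the even tori `(ℤ/2kℤ)³` have long-range order, and there is
`β₀ > 0` with long-range order in the Gibbs state for all `β ≥ β₀`. (hubbard-cq's conditional theorem with its Watson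
hypothesis discharged by the summit-side kernel decimal `latticeGreen 0 ≤ 13/25`.) Comparison model only. -/
theorem xyLayered_longRangeOrder_half_le_one {r : ℝ} (hr : 1 / 2 ≤ r) (hr1 : r ≤ 1) {n : ℕ} (hn : 1 ≤ n) :
    HasEvenTorusLRO (fun L x y => xyAnisoGroundCorr 0 L n (layeredCoupling 1 r) x y +
        xyAnisoGroundCorr 1 L n (layeredCoupling 1 r) x y) ∧
      ∃ β₀ : ℝ, 0 < β₀ ∧ ∀ β : ℝ, β₀ ≤ β →
        HasEvenTorusLRO (fun L x y => xyAnisoThermalCorr β (layeredCoupling 1 r) L n x y) :=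
  xyLayered_longRangeOrder_of_latticeGreen_le hr hr1 hn latticeGreen_zero_le

/-- **The kernel window on `C(r)` for `½ ≤ r ≤ 1`**:
`1/6 + log(1/r)/(2π) ≤ C(r) ≤ min(13/(25r), 1 + log(1/r)/(2π))` (floats: `C(1) = 0.5055`, `C(½) = 0.625`).
Comparison model only. -/
theorem klsConstant_window_half_le_one {r : ℝ} (hr : 1 / 2 ≤ r) (hr1 : r ≤ 1) :
    1 / 6 + Real.log (1 / r) / (2 * Real.pi) ≤ klsConstant r ∧
      klsConstant r ≤ min (13 / 25 / r) (1 + Real.log (1 / r) / (2 * Real.pi)) := by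
  have hr0 : 0 < r := lt_of_lt_of_le (by norm_num) hr
  refine ⟨klsConstant_ge_log hr0 hr1, le_min ?_ (klsConstant_le_log hr0 hr1)⟩
  exact (klsConstant_le_latticeGreen_div hr0 hr1).trans (div_le_div_of_nonneg_right latticeGreen_zero_le hr0.le)

end Summit.Ventures.CertifiedManyBodySolver.Observables

end
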